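import Mathlib
import HarnessLib

/-!
# `FemtoCurvatureSkewness` — stub `TotalCumulance` of line `Sketch-ideator3` (crux stmt-QuantumFields-9365)

Brillinger's law of total cumulance at order 3 (port of `Cruxes/FemtoCurvatureSkewness/SketchG2I1.lean`,
`total_cumulance3`, which is proved there with local defs `cum3`, `condCov`, `condCum3` — here expanded).
-/

noncomputable section

namespace Summit.QuantumFields.YangMills.Theorems.FemtoCurvatureSkewness

open MeasureTheory ProbabilityTheory

/-- Working form of the law of total cumulance at order 3: the conditional covariances
`Cyz, Cxz, Cxy` and the conditional third cumulant `C3` are abstract functions pinned down by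
the equations `hCyz, hCxz, hCxy, hC3` (binder convention: the sub-σ-algebra `m` is bound before
the ambient `mΩ`, so `∫`, `Measurable`, `Measure` refer to `mΩ` and `μ[·|m]` conditions on `m`).
Adapted from `Cruxes/FemtoCurvatureSkewness/SketchG2I1.lean`, `total_cumulance3`. -/
theorem TotalCumulance_aux {Ω : Type*} {m mΩ : MeasurableSpace Ω} (hm : m ≤ mΩ) (μ : Measure Ω)
    [IsProbabilityMeasure μ] {X Y Z : Ω → ℝ} (hX : Measurable X) (hY : Measurable Y)
    (hZ : Measurable Z) (hb : ∃ M : ℝ, ∀ ω, |X ω| ≤ M ∧ |Y ω| ≤ M ∧ |Z ω| ≤ M)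
    {Cyz Cxz Cxy C3 : Ω → ℝ}
    (hCyz : Cyz = fun ω => (μ[fun a => Y a * Z a|m]) ω - (μ[Y|m]) ω * (μ[Z|m]) ω)
    (hCxz : Cxz = fun ω => (μ[fun a => X a * Z a|m]) ω - (μ[X|m]) ω * (μ[Z|m]) ω)
    (hCxy : Cxy = fun ω => (μ[fun a => X a * Y a|m]) ω - (μ[X|m]) ω * (μ[Y|m]) ω)
    (hC3 : C3 = fun ω => (μ[fun a => X a * Y a * Z a|m]) ω
      - (μ[X|m]) ω * Cyz ω - (μ[Y|m]) ω * Cxz ω - (μ[Z|m]) ω * Cxy ω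
      - (μ[X|m]) ω * (μ[Y|m]) ω * (μ[Z|m]) ω) :
    ∫ ω, (X ω - ∫ a, X a ∂μ) * (Y ω - ∫ a, Y a ∂μ) * (Z ω - ∫ a, Z a ∂μ) ∂μ =
      (∫ ω, C3 ω ∂μ)
      + (∫ ω, ((μ[X|m]) ω - ∫ a, X a ∂μ) * Cyz ω ∂μ)
      + (∫ ω, ((μ[Y|m]) ω - ∫ a, Y a ∂μ) * Cxz ω ∂μ)
      + (∫ ω, ((μ[Z|m]) ω - ∫ a, Z a ∂μ) * Cxy ω ∂μ)
      + ∫ ω, ((μ[X|m]) ω - ∫ a, X a ∂μ) * ((μ[Y|m]) ω - ∫ a, Y a ∂μ)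
          * ((μ[Z|m]) ω - ∫ a, Z a ∂μ) ∂μ := by
  -- pointwise forms of the defining equations
  have eCyz : ∀ ω, Cyz ω = (μ[fun a => Y a * Z a|m]) ω - (μ[Y|m]) ω * (μ[Z|m]) ω :=
    fun ω => by rw [hCyz]
  have eCxz : ∀ ω, Cxz ω = (μ[fun a => X a * Z a|m]) ω - (μ[X|m]) ω * (μ[Z|m]) ω :=
    fun ω => by rw [hCxz]
  have eCxy : ∀ ω, Cxy ω = (μ[fun a => X a * Y a|m]) ω - (μ[X|m]) ω * (μ[Y|m]) ω :=
    fun ω => by rw [hCxy]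
  have eC3 : ∀ ω, C3 ω = (μ[fun a => X a * Y a * Z a|m]) ω
      - (μ[X|m]) ω * Cyz ω - (μ[Y|m]) ω * Cxz ω - (μ[Z|m]) ω * Cxy ω
      - (μ[X|m]) ω * (μ[Y|m]) ω * (μ[Z|m]) ω :=
    fun ω => by rw [hC3]
  obtain ⟨M, hM⟩ := hb
  set K : ℝ := max M 1 with hKdef
  have hK0 : 0 ≤ K := le_trans zero_le_one (le_max_right _ _)
  have bX : ∀ ω, |X ω| ≤ K := fun ω => (hM ω).1.trans (le_max_left _ _)
  have bY : ∀ ω, |Y ω| ≤ K := fun ω => (hM ω).2.1.trans (le_max_left _ _)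
  have bZ : ∀ ω, |Z ω| ≤ K := fun ω => (hM ω).2.2.trans (le_max_left _ _)
  -- integrability of bounded measurable functions
  have hint : ∀ (f : Ω → ℝ) (C : ℝ), Measurable f → (∀ ω, |f ω| ≤ C) → Integrable f μ :=
    fun f C hf hC => Integrable.of_bound hf.aestronglyMeasurable C
      (Filter.Eventually.of_forall fun ω => by rw [Real.norm_eq_abs]; exact hC ω)
  have bXY : ∀ ω, |X ω * Y ω| ≤ K * K := fun ω => by
    rw [abs_mul]; exact mul_le_mul (bX ω) (bY ω) (abs_nonneg _) hK0
  have bXZ : ∀ ω, |X ω * Z ω| ≤ K * K := fun ω => by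
    rw [abs_mul]; exact mul_le_mul (bX ω) (bZ ω) (abs_nonneg _) hK0
  have bYZ : ∀ ω, |Y ω * Z ω| ≤ K * K := fun ω => by
    rw [abs_mul]; exact mul_le_mul (bY ω) (bZ ω) (abs_nonneg _) hK0
  have bXYZ : ∀ ω, |X ω * Y ω * Z ω| ≤ K * K * K := fun ω => by
    rw [abs_mul]; exact mul_le_mul (bXY ω) (bZ ω) (abs_nonneg _) (mul_nonneg hK0 hK0)
  have iX : Integrable X μ := hint X K hX bX
  have iY : Integrable Y μ := hint Y K hY bY
  have iZ : Integrable Z μ := hint Z K hZ bZ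
  have iXY : Integrable (fun ω => X ω * Y ω) μ := hint _ _ (hX.mul hY) bXY
  have iXZ : Integrable (fun ω => X ω * Z ω) μ := hint _ _ (hX.mul hZ) bXZ
  have iYZ : Integrable (fun ω => Y ω * Z ω) μ := hint _ _ (hY.mul hZ) bYZ
  have iXYZ : Integrable (fun ω => X ω * Y ω * Z ω) μ := hint _ _ ((hX.mul hY).mul hZ) bXYZ
  -- conditional expectations: integrable, measurable, bounded a.e.
  have iXh : Integrable (μ[X|m]) μ := integrable_condExp
  have iYh : Integrable (μ[Y|m]) μ := integrable_condExp
  have iZh : Integrable (μ[Z|m]) μ := integrable_condExp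
  have iWxy : Integrable (μ[fun a => X a * Y a|m]) μ := integrable_condExp
  have iWxz : Integrable (μ[fun a => X a * Z a|m]) μ := integrable_condExp
  have iWyz : Integrable (μ[fun a => Y a * Z a|m]) μ := integrable_condExp
  have iWxyz : Integrable (μ[fun a => X a * Y a * Z a|m]) μ := integrable_condExp
  have mXh : AEStronglyMeasurable (μ[X|m]) μ := iXh.aestronglyMeasurable
  have mYh : AEStronglyMeasurable (μ[Y|m]) μ := iYh.aestronglyMeasurable
  have mZh : AEStronglyMeasurable (μ[Z|m]) μ := iZh.aestronglyMeasurable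
  have aX : ∀ᵐ ω ∂μ, |(μ[X|m]) ω| ≤ K :=
    ae_bdd_abs_condExp_of_ae_bdd_abs (Filter.Eventually.of_forall bX)
  have aY : ∀ᵐ ω ∂μ, |(μ[Y|m]) ω| ≤ K :=
    ae_bdd_abs_condExp_of_ae_bdd_abs (Filter.Eventually.of_forall bY)
  have aZ : ∀ᵐ ω ∂μ, |(μ[Z|m]) ω| ≤ K :=
    ae_bdd_abs_condExp_of_ae_bdd_abs (Filter.Eventually.of_forall bZ)
  -- norms instead of abs
  have nX : ∀ᵐ ω ∂μ, ‖(μ[X|m]) ω‖ ≤ K := aX.mono fun ω h => by rwa [Real.norm_eq_abs]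
  have nY : ∀ᵐ ω ∂μ, ‖(μ[Y|m]) ω‖ ≤ K := aY.mono fun ω h => by rwa [Real.norm_eq_abs]
  have nZ : ∀ᵐ ω ∂μ, ‖(μ[Z|m]) ω‖ ≤ K := aZ.mono fun ω h => by rwa [Real.norm_eq_abs]
  have nXa : ∀ᵐ ω ∂μ, ‖(μ[X|m]) ω - ∫ a, X a ∂μ‖ ≤ K + ‖∫ a, X a ∂μ‖ :=
    nX.mono fun ω h => (norm_sub_le _ _).trans (by linarith)
  have nYb : ∀ᵐ ω ∂μ, ‖(μ[Y|m]) ω - ∫ a, Y a ∂μ‖ ≤ K + ‖∫ a, Y a ∂μ‖ :=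
    nY.mono fun ω h => (norm_sub_le _ _).trans (by linarith)
  have nZc : ∀ᵐ ω ∂μ, ‖(μ[Z|m]) ω - ∫ a, Z a ∂μ‖ ≤ K + ‖∫ a, Z a ∂μ‖ :=
    nZ.mono fun ω h => (norm_sub_le _ _).trans (by linarith)
  have nXY : ∀ᵐ ω ∂μ, ‖(μ[X|m]) ω * (μ[Y|m]) ω‖ ≤ K * K := by
    filter_upwards [nX, nY] with ω h1 h2
    rw [norm_mul]; exact mul_le_mul h1 h2 (norm_nonneg _) hK0
  have nXaYb : ∀ᵐ ω ∂μ, ‖((μ[X|m]) ω - ∫ a, X a ∂μ) * ((μ[Y|m]) ω - ∫ a, Y a ∂μ)‖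
      ≤ (K + ‖∫ a, X a ∂μ‖) * (K + ‖∫ a, Y a ∂μ‖) := by
    filter_upwards [nXa, nYb] with ω h1 h2
    rw [norm_mul]
    exact mul_le_mul h1 h2 (norm_nonneg _) (by positivity)
  -- products
  have iYhZh : Integrable (fun ω => (μ[Y|m]) ω * (μ[Z|m]) ω) μ := iZh.bdd_mul mYh nY
  have iXhZh : Integrable (fun ω => (μ[X|m]) ω * (μ[Z|m]) ω) μ := iZh.bdd_mul mXh nX
  have iXhYh : Integrable (fun ω => (μ[X|m]) ω * (μ[Y|m]) ω) μ := iYh.bdd_mul mXh nX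
  have iCyz : Integrable Cyz μ := by rw [hCyz]; exact iWyz.sub iYhZh
  have iCxz : Integrable Cxz μ := by rw [hCxz]; exact iWxz.sub iXhZh
  have iCxy : Integrable Cxy μ := by rw [hCxy]; exact iWxy.sub iXhYh
  have iXhYhZh : Integrable (fun ω => (μ[X|m]) ω * (μ[Y|m]) ω * (μ[Z|m]) ω) μ :=
    iZh.bdd_mul (mXh.mul mYh) nXY
  have i1 : Integrable (fun ω => C3 ω) μ := by
    have h1 : Integrable (fun ω => (μ[X|m]) ω * Cyz ω) μ := iCyz.bdd_mul mXh nX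
    have h2 : Integrable (fun ω => (μ[Y|m]) ω * Cxz ω) μ := iCxz.bdd_mul mYh nY
    have h3 : Integrable (fun ω => (μ[Z|m]) ω * Cxy ω) μ := iCxy.bdd_mul mZh nZ
    rw [hC3]
    exact (((iWxyz.sub h1).sub h2).sub h3).sub iXhYhZh
  have i2 : Integrable (fun ω => ((μ[X|m]) ω - ∫ a, X a ∂μ) * Cyz ω) μ :=
    iCyz.bdd_mul (mXh.sub aestronglyMeasurable_const) nXa
  have i3 : Integrable (fun ω => ((μ[Y|m]) ω - ∫ a, Y a ∂μ) * Cxz ω) μ :=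
    iCxz.bdd_mul (mYh.sub aestronglyMeasurable_const) nYb
  have i4 : Integrable (fun ω => ((μ[Z|m]) ω - ∫ a, Z a ∂μ) * Cxy ω) μ :=
    iCxy.bdd_mul (mZh.sub aestronglyMeasurable_const) nZc
  have i5 : Integrable (fun ω => ((μ[X|m]) ω - ∫ a, X a ∂μ) * ((μ[Y|m]) ω - ∫ a, Y a ∂μ)
      * ((μ[Z|m]) ω - ∫ a, Z a ∂μ)) μ :=
    (iZh.sub (integrable_const _)).bdd_mul
      ((mXh.sub aestronglyMeasurable_const).mul (mYh.sub aestronglyMeasurable_const)) nXaYb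
  -- Step 1: merge the five integrals
  have i12 : Integrable (fun ω => C3 ω
      + ((μ[X|m]) ω - ∫ a, X a ∂μ) * Cyz ω) μ := i1.add i2
  have i123 : Integrable (fun ω => C3 ω
      + ((μ[X|m]) ω - ∫ a, X a ∂μ) * Cyz ω
      + ((μ[Y|m]) ω - ∫ a, Y a ∂μ) * Cxz ω) μ := i12.add i3
  have i1234 : Integrable (fun ω => C3 ω
      + ((μ[X|m]) ω - ∫ a, X a ∂μ) * Cyz ω
      + ((μ[Y|m]) ω - ∫ a, Y a ∂μ) * Cxz ω
      + ((μ[Z|m]) ω - ∫ a, Z a ∂μ) * Cxy ω) μ := i123.add i4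
  rw [← integral_add i1 i2, ← integral_add i12 i3, ← integral_add i123 i4, ← integral_add i1234 i5]
  -- Step 2: the merged integrand is a LINEAR combination of conditional expectations
  have hlin : ∀ ω, C3 ω + ((μ[X|m]) ω - ∫ a, X a ∂μ) * Cyz ω
      + ((μ[Y|m]) ω - ∫ a, Y a ∂μ) * Cxz ω
      + ((μ[Z|m]) ω - ∫ a, Z a ∂μ) * Cxy ω
      + ((μ[X|m]) ω - ∫ a, X a ∂μ) * ((μ[Y|m]) ω - ∫ a, Y a ∂μ) * ((μ[Z|m]) ω - ∫ a, Z a ∂μ)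
      = (μ[fun a => X a * Y a * Z a|m]) ω - (∫ a, X a ∂μ) * (μ[fun a => Y a * Z a|m]) ω
        - (∫ a, Y a ∂μ) * (μ[fun a => X a * Z a|m]) ω
        - (∫ a, Z a ∂μ) * (μ[fun a => X a * Y a|m]) ω
        + (∫ a, X a ∂μ) * (∫ a, Y a ∂μ) * (μ[Z|m]) ω
        + (∫ a, X a ∂μ) * (∫ a, Z a ∂μ) * (μ[Y|m]) ω
        + (∫ a, Y a ∂μ) * (∫ a, Z a ∂μ) * (μ[X|m]) ω
        - (∫ a, X a ∂μ) * (∫ a, Y a ∂μ) * (∫ a, Z a ∂μ) := fun ω => by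
    rw [eC3, eCyz, eCxz, eCxy]
    ring
  simp_rw [hlin]
  -- Step 3: integrate the linear combination termwise
  have g1 : Integrable (fun ω => (μ[fun a => X a * Y a * Z a|m]) ω
      - (∫ a, X a ∂μ) * (μ[fun a => Y a * Z a|m]) ω) μ := iWxyz.sub (iWyz.const_mul _)
  have g2 : Integrable (fun ω => (μ[fun a => X a * Y a * Z a|m]) ω
      - (∫ a, X a ∂μ) * (μ[fun a => Y a * Z a|m]) ω
      - (∫ a, Y a ∂μ) * (μ[fun a => X a * Z a|m]) ω) μ := g1.sub (iWxz.const_mul _)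
  have g3 : Integrable (fun ω => (μ[fun a => X a * Y a * Z a|m]) ω
      - (∫ a, X a ∂μ) * (μ[fun a => Y a * Z a|m]) ω
      - (∫ a, Y a ∂μ) * (μ[fun a => X a * Z a|m]) ω
      - (∫ a, Z a ∂μ) * (μ[fun a => X a * Y a|m]) ω) μ := g2.sub (iWxy.const_mul _)
  have g4 : Integrable (fun ω => (μ[fun a => X a * Y a * Z a|m]) ω
      - (∫ a, X a ∂μ) * (μ[fun a => Y a * Z a|m]) ω
      - (∫ a, Y a ∂μ) * (μ[fun a => X a * Z a|m]) ω
      - (∫ a, Z a ∂μ) * (μ[fun a => X a * Y a|m]) ω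
      + (∫ a, X a ∂μ) * (∫ a, Y a ∂μ) * (μ[Z|m]) ω) μ := g3.add (iZh.const_mul _)
  have g5 : Integrable (fun ω => (μ[fun a => X a * Y a * Z a|m]) ω
      - (∫ a, X a ∂μ) * (μ[fun a => Y a * Z a|m]) ω
      - (∫ a, Y a ∂μ) * (μ[fun a => X a * Z a|m]) ω
      - (∫ a, Z a ∂μ) * (μ[fun a => X a * Y a|m]) ω
      + (∫ a, X a ∂μ) * (∫ a, Y a ∂μ) * (μ[Z|m]) ω
      + (∫ a, X a ∂μ) * (∫ a, Z a ∂μ) * (μ[Y|m]) ω) μ := g4.add (iYh.const_mul _)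
  have g6 : Integrable (fun ω => (μ[fun a => X a * Y a * Z a|m]) ω
      - (∫ a, X a ∂μ) * (μ[fun a => Y a * Z a|m]) ω
      - (∫ a, Y a ∂μ) * (μ[fun a => X a * Z a|m]) ω
      - (∫ a, Z a ∂μ) * (μ[fun a => X a * Y a|m]) ω
      + (∫ a, X a ∂μ) * (∫ a, Y a ∂μ) * (μ[Z|m]) ω
      + (∫ a, X a ∂μ) * (∫ a, Z a ∂μ) * (μ[Y|m]) ω
      + (∫ a, Y a ∂μ) * (∫ a, Z a ∂μ) * (μ[X|m]) ω) μ := g5.add (iXh.const_mul _)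
  rw [integral_sub g6 (integrable_const _), integral_add g5 (iXh.const_mul _),
    integral_add g4 (iYh.const_mul _), integral_add g3 (iZh.const_mul _),
    integral_sub g2 (iWxy.const_mul _), integral_sub g1 (iWxz.const_mul _),
    integral_sub iWxyz (iWyz.const_mul _)]
  simp only [integral_const_mul, integral_const, probReal_univ, one_smul, integral_condExp hm]
  -- Step 4: expand the left-hand side the same way
  have hl : ∀ ω, (X ω - ∫ a, X a ∂μ) * (Y ω - ∫ a, Y a ∂μ) * (Z ω - ∫ a, Z a ∂μ)
      = X ω * Y ω * Z ω - (∫ a, X a ∂μ) * (Y ω * Z ω) - (∫ a, Y a ∂μ) * (X ω * Z ω)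
        - (∫ a, Z a ∂μ) * (X ω * Y ω)
        + (∫ a, X a ∂μ) * (∫ a, Y a ∂μ) * Z ω + (∫ a, X a ∂μ) * (∫ a, Z a ∂μ) * Y ω
        + (∫ a, Y a ∂μ) * (∫ a, Z a ∂μ) * X ω
        - (∫ a, X a ∂μ) * (∫ a, Y a ∂μ) * (∫ a, Z a ∂μ) := fun ω => by ring
  simp_rw [hl]
  have f1 : Integrable (fun ω => X ω * Y ω * Z ω - (∫ a, X a ∂μ) * (Y ω * Z ω)) μ :=
    iXYZ.sub (iYZ.const_mul _)
  have f2 : Integrable (fun ω => X ω * Y ω * Z ω - (∫ a, X a ∂μ) * (Y ω * Z ω)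
      - (∫ a, Y a ∂μ) * (X ω * Z ω)) μ := f1.sub (iXZ.const_mul _)
  have f3 : Integrable (fun ω => X ω * Y ω * Z ω - (∫ a, X a ∂μ) * (Y ω * Z ω)
      - (∫ a, Y a ∂μ) * (X ω * Z ω) - (∫ a, Z a ∂μ) * (X ω * Y ω)) μ := f2.sub (iXY.const_mul _)
  have f4 : Integrable (fun ω => X ω * Y ω * Z ω - (∫ a, X a ∂μ) * (Y ω * Z ω)
      - (∫ a, Y a ∂μ) * (X ω * Z ω) - (∫ a, Z a ∂μ) * (X ω * Y ω)
      + (∫ a, X a ∂μ) * (∫ a, Y a ∂μ) * Z ω) μ := f3.add (iZ.const_mul _)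
  have f5 : Integrable (fun ω => X ω * Y ω * Z ω - (∫ a, X a ∂μ) * (Y ω * Z ω)
      - (∫ a, Y a ∂μ) * (X ω * Z ω) - (∫ a, Z a ∂μ) * (X ω * Y ω)
      + (∫ a, X a ∂μ) * (∫ a, Y a ∂μ) * Z ω + (∫ a, X a ∂μ) * (∫ a, Z a ∂μ) * Y ω) μ :=
    f4.add (iY.const_mul _)
  have f6 : Integrable (fun ω => X ω * Y ω * Z ω - (∫ a, X a ∂μ) * (Y ω * Z ω)
      - (∫ a, Y a ∂μ) * (X ω * Z ω) - (∫ a, Z a ∂μ) * (X ω * Y ω)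
      + (∫ a, X a ∂μ) * (∫ a, Y a ∂μ) * Z ω + (∫ a, X a ∂μ) * (∫ a, Z a ∂μ) * Y ω
      + (∫ a, Y a ∂μ) * (∫ a, Z a ∂μ) * X ω) μ := f5.add (iX.const_mul _)
  rw [integral_sub f6 (integrable_const _), integral_add f5 (iX.const_mul _),
    integral_add f4 (iY.const_mul _), integral_add f3 (iZ.const_mul _),
    integral_sub f2 (iXY.const_mul _), integral_sub f1 (iXZ.const_mul _),
    integral_sub iXYZ (iYZ.const_mul _)]
  simp only [integral_const_mul, integral_const, probReal_univ, one_smul]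

/-- **Law of total cumulance, order 3** (stub `TotalCumulance`, registered signature verbatim):
`κ₃(X,Y,Z) = E κ₃(X,Y,Z | m) + Σ₃ E[(E[X|m] − EX)·Cov(Y,Z|m)] + κ₃(E[X|m],E[Y|m],E[Z|m])`
for bounded measurable `X, Y, Z`, a probability measure and any sub-σ-algebra `m ≤ mΩ`
(Brillinger 1969; the three terms with exactly one conditioned factor vanish by the tower
property). Port of `Cruxes/FemtoCurvatureSkewness/SketchG2I1.lean`, `total_cumulance3`, with
its local defs `cum3`, `condCov`, `condCum3` unfolded. -/
theorem TotalCumulance :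
  ∀ (Ω : Type) (m mΩ : MeasurableSpace Ω) (μ : Measure Ω) [IsProbabilityMeasure μ], m ≤ mΩ →
    ∀ (X Y Z : Ω → ℝ), Measurable X → Measurable Y → Measurable Z →
      (∃ M : ℝ, ∀ ω, |X ω| ≤ M ∧ |Y ω| ≤ M ∧ |Z ω| ≤ M) →
      ∫ ω, (X ω - ∫ a, X a ∂μ) * (Y ω - ∫ a, Y a ∂μ) * (Z ω - ∫ a, Z a ∂μ) ∂μ =
        (∫ ω, ((μ[fun a => X a * Y a * Z a|m]) ω
            - (μ[X|m]) ω * ((μ[fun a => Y a * Z a|m]) ω - (μ[Y|m]) ω * (μ[Z|m]) ω)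
            - (μ[Y|m]) ω * ((μ[fun a => X a * Z a|m]) ω - (μ[X|m]) ω * (μ[Z|m]) ω)
            - (μ[Z|m]) ω * ((μ[fun a => X a * Y a|m]) ω - (μ[X|m]) ω * (μ[Y|m]) ω)
            - (μ[X|m]) ω * (μ[Y|m]) ω * (μ[Z|m]) ω) ∂μ)
        + (∫ ω, ((μ[X|m]) ω - ∫ a, X a ∂μ) * ((μ[fun a => Y a * Z a|m]) ω - (μ[Y|m]) ω * (μ[Z|m]) ω) ∂μ)
        + (∫ ω, ((μ[Y|m]) ω - ∫ a, Y a ∂μ) * ((μ[fun a => X a * Z a|m]) ω - (μ[X|m]) ω * (μ[Z|m]) ω) ∂μ)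
        + (∫ ω, ((μ[Z|m]) ω - ∫ a, Z a ∂μ) * ((μ[fun a => X a * Y a|m]) ω - (μ[X|m]) ω * (μ[Y|m]) ω) ∂μ)
        + ∫ ω, ((μ[X|m]) ω - ∫ a, X a ∂μ) * ((μ[Y|m]) ω - ∫ a, Y a ∂μ) * ((μ[Z|m]) ω - ∫ a, Z a ∂μ) ∂μ := by
  intro Ω m mΩ μ _ hm X Y Z hX hY hZ hb
  exact TotalCumulance_aux hm μ hX hY hZ hb rfl rfl rfl rfl

end Summit.QuantumFields.YangMills.Theorems.FemtoCurvatureSkewness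

end
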